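/-
Literature anchor (engines group, cap lane, anchor #22): the BILINEAR (cross-term) form of the
geometric-tail estimates of the Kuramoto–Sivashinsky nonlinearity — Wilczak–Zgliczyński (2020),
§5.2 Lemmas 19 and 21 for two sequences in `GBound(m, ã, S, q)` and `GBound(m, b̃, T, q)` — and
the resulting bound of the derivative `DN_k(a)v` of the KS field along a geometrically bounded
direction `v` (the variational / C¹ setting of the self-consistent bounds method).
-/
import Mathlib
import Literature.Analysis.ODE.GeometricDecayConvolution
import HarnessLib

/-!
# Bilinear geometric-tail estimates and the derivative of the KS nonlinearity

Topic `Literature/Analysis/ODE`; continuation of `GeometricDecayConvolution.lean` (the quadratic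
case `v = a`).  In the Taylor method of [WilczakZgliczynski2020, §5.2] the `i`-th time-Taylor
coefficient of the KS nonlinearity is a sum over `j = 0, …, i` of CROSS TERMS
`Σ_n a^{[j]}_n a^{[i-j]}_{n+k}`, `Σ_n a^{[j]}_n a^{[i-j]}_{k-n}` of two different sequences, each in
its own geometric bound `GBound(m, ã^{[j]}, S_j, q_j)`; Lemmas 19 and 21 there bound every cross
term with the common ratio `q = min_j q_j`.  Exactly the same cross terms make up the derivative
of the (quadratic) KS field `N_k(a) = -k Σ_{n=1}^{k-1} a_n a_{k-n} + 2k Σ_{n≥1} a_n a_{n+k}` in a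
direction `v`:
`DN_k(a)v = -2k Σ_{n=1}^{k-1} a_n v_{k-n} + 2k Σ_{n≥1} (a_n v_{n+k} + a_{n+k} v_n)`,
the right-hand side of the variational equation `v' = L v + DN(a) v` whose columns are integrated
on product sets `W × W_{V_j}` in the C¹ version of the method ([WilczakZgliczynski2025, §7,
Thm. 20: `∂φ/∂x_j = V_{*j}`, the variational equation (eq. for `V`)]).  This file proves, for
real sequences `a, v : ℕ → ℝ` with `|a_n| ≤ ã_n`, `|v_n| ≤ b̃_n` (`1 ≤ n ≤ m`) and
`|a_n| ≤ S q^{-n}`, `|v_n| ≤ T q^{-n}` (`n > m`, `q > 1`), every infinite sum being stated for all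
its finite partial sums:

* `ks_quadratic_polarization`, `sum_Ioo_mul_sub_comm` — the algebra: `N_k(a + v) = N_k(a) +
  DN_k(a)v + N_k(v)` for every truncation (so `DN_k(a)` IS the derivative of the quadratic map
  `N_k`, and second differences of `N` are `N` of the difference).
* `sum_abs_mul_add_le_of_tail₂` — [WilczakZgliczynski2020, §5.2 Lemma 19], cross term:
  `Σ_{n∈J, n>m} |a_n| |v_{n+k}| ≤ S T q^{-k} q^{-2m}/(q²-1)`.
* `sum_Icc_abs_mul_sub_le₂`, `sum_Icc_abs_mul_add_le₂`, `sum_Ioo_abs_mul_sub_le₂`,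
  `sum_Ioo_abs_mul_sub_le_of_gbound₂`, `sum_abs_mul_add_le_of_gbound₂` —
  [WilczakZgliczynski2020, §5.2 Lemma 21], cross terms (blocks `Σ₁`, `Σ₂` of its proof with the
  exact count): for `k > 2m`,
  `Σ_{n=1}^{k-1} |a_n| |v_{k-n}| ≤ q^{-k} (T Σ_{n≤m} q^n ã_n + S Σ_{n≤m} q^n b̃_n + S T (k-2m-1))`,
  and for `k > m`, `Σ_{n∈J} |a_n| |v_{n+k}| ≤ q^{-k} T (Σ_{n≤m} q^{-n} ã_n + S q^{-2m}/(q²-1))`.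
* `ks_derivative_le_of_gbound`, `ks_derivative_abs_le_of_gbound`, `ks_derivative_le_of_gbound'`
  — the bound of `DN_k(a)v` at a far mode `k > 2m`:
  `|DN_k(a)v| ≤ q^{-k} k (c₁ⱽ + c₂ⱽ (k-2m-1)) ≤ q^{-k} k (c₁ⱽ + c₂ⱽ k)` with
  `c₁ⱽ = 2 (T·Σ q^n ã_n + S·Σ q^n b̃_n + T·(Σ q^{-n} ã_n + S q^{-2m}/(q²-1))
          + S·(Σ q^{-n} b̃_n + T q^{-2m}/(q²-1)))`, `c₂ⱽ = 2 S T`;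
  the uniform-in-`k` ratio to the linear part then follows from `far_weighted_le`
  (`GeometricDecayConvolution.lean`): `q^k |DN_k(a)v|/(νk⁴ - k²) ≤ (c₁ⱽ/K + c₂ⱽ)/(νK² - 1)` for
  `k ≥ K > 2m`, `νK² > 1` (`ks_derivative_far_ratio_le`).
* `ks_quadratic_le_of_gbound'` — the same weakening `(k-2m-1) ≤ k` for the quadratic bound of
  `GeometricDecayConvolution.lean`.

What this buys (cap lane): these are the C¹ PASSENGER formulas (BV2)–(BV4) of the
`ks-odd-periodic` kind of `cap.pde` for the geometric weight — `q^i T1 ≤ SV·SA + S·SVq +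
(i-2M-1)⁺ S SV`, `q^i T2 ≤ SV·B2`, `q^i T3 ≤ S·BV2`, `c1V = 2(SV SA + S SVq + SV B2 + S BV2)`,
`c2V = 2 S SV`, `FARV = (c1V/(2M+1) + c2V)/(ν(2M+1)² - 1)` — with the dictionary paper `m` = engine
`M`, `T` = `SV`, `b̃` = `β`; the uniform-weight (`uni`) variants are the engine's own and are not
stated here.  No facts, no axioms, no `sorry`.

## References

* D. Wilczak, P. Zgliczyński, *A geometric method for infinite-dimensional chaos: symbolic
  dynamics for the Kuramoto–Sivashinsky PDE on the line*, J. Differential Equations 269 (2020)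
  8509–8548, §5.1 (`N_k` for KS), §5.2 Lemmas 19–21 (general Taylor order `i`: cross terms).
  [WilczakZgliczynski2020; held: paper:arxiv-1710.00329, pp. 14–15]
* D. Wilczak, P. Zgliczyński, *Self-consistent bounds method for dissipative PDEs*,
  arXiv:2502.09760 (2025), §7 (C¹ convergence; the variational equation on `W × W_{V_j}`).
  [WilczakZgliczynski2025]
-/

noncomputable section

open Finset

namespace Literature.Analysis.ODE

/-! ### Algebra: the derivative of the quadratic KS field -/

/-- Reflection `n ↦ k - n` of the finite convolution range: `Σ_{0<n<k} v_n a_{k-n} =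
Σ_{0<n<k} a_n v_{k-n}`. [cite: WilczakZgliczynski2020, §5.1 (N_k for KS: the finite part E_k)] -/
theorem sum_Ioo_mul_sub_comm (k : ℕ) (a v : ℕ → ℝ) :
    ∑ n ∈ Finset.Ioo 0 k, v n * a (k - n) = ∑ n ∈ Finset.Ioo 0 k, a n * v (k - n) := by
  classical
  have hinj : Set.InjOn (fun n : ℕ => k - n) ↑(Finset.Ioo 0 k) := by
    intro x hx y hy hxy
    simp only [Finset.coe_Ioo, Set.mem_Ioo] at hx hy
    simp only at hxy
    omega
  have himg : (Finset.Ioo 0 k).image (fun n : ℕ => k - n) = Finset.Ioo 0 k := by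
    ext j
    simp only [Finset.mem_image, Finset.mem_Ioo]
    constructor
    · rintro ⟨n, hn, rfl⟩
      omega
    · intro hj
      exact ⟨k - j, by omega, by omega⟩
  calc ∑ n ∈ Finset.Ioo 0 k, v n * a (k - n)
      = ∑ n ∈ Finset.Ioo 0 k, v (k - (k - n)) * a (k - n) := by
        refine Finset.sum_congr rfl (fun n hn => ?_)
        rw [Finset.mem_Ioo] at hn
        rw [Nat.sub_sub_self (by omega : n ≤ k)]
    _ = ∑ j ∈ (Finset.Ioo 0 k).image (fun n : ℕ => k - n), v (k - j) * a j :=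
        (Finset.sum_image (f := fun j : ℕ => v (k - j) * a j) hinj).symm
    _ = ∑ n ∈ Finset.Ioo 0 k, a n * v (k - n) := by
        rw [himg]
        exact Finset.sum_congr rfl (fun j _ => mul_comm _ _)

/-- **Polarization of the KS nonlinearity.** For every mode `k`, every truncation `J` of the
infinite sum and all real sequences `a, v`: `N_k(a + v) = N_k(a) + DN_k(a)v + N_k(v)` with
`N_k(a) = -k Σ_{0<n<k} a_n a_{k-n} + 2k Σ_{n∈J} a_n a_{n+k}` and
`DN_k(a)v = -2k Σ_{0<n<k} a_n v_{k-n} + 2k Σ_{n∈J} (a_n v_{n+k} + a_{n+k} v_n)` — so `DN_k(a)` is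
the derivative of the quadratic map `N_k` at `a`.
[cite: WilczakZgliczynski2020, §5.1 (N_k = -k Σ a_n a_{k-n} + 2k Σ a_n a_{n+k} for KS)] -/
theorem ks_quadratic_polarization (k : ℕ) (J : Finset ℕ) (a v : ℕ → ℝ) :
    (-(k : ℝ) * ∑ n ∈ Finset.Ioo 0 k, (a n + v n) * (a (k - n) + v (k - n)) +
        2 * (k : ℝ) * ∑ n ∈ J, (a n + v n) * (a (n + k) + v (n + k))) =
      (-(k : ℝ) * ∑ n ∈ Finset.Ioo 0 k, a n * a (k - n) +
          2 * (k : ℝ) * ∑ n ∈ J, a n * a (n + k)) +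
        (-2 * (k : ℝ) * ∑ n ∈ Finset.Ioo 0 k, a n * v (k - n) +
          2 * (k : ℝ) * ∑ n ∈ J, (a n * v (n + k) + a (n + k) * v n)) +
        (-(k : ℝ) * ∑ n ∈ Finset.Ioo 0 k, v n * v (k - n) +
          2 * (k : ℝ) * ∑ n ∈ J, v n * v (n + k)) := by
  have h1 : ∑ n ∈ Finset.Ioo 0 k, (a n + v n) * (a (k - n) + v (k - n)) =
      ∑ n ∈ Finset.Ioo 0 k, a n * a (k - n) + ∑ n ∈ Finset.Ioo 0 k, a n * v (k - n) +
        ∑ n ∈ Finset.Ioo 0 k, v n * a (k - n) + ∑ n ∈ Finset.Ioo 0 k, v n * v (k - n) := by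
    rw [← Finset.sum_add_distrib, ← Finset.sum_add_distrib, ← Finset.sum_add_distrib]
    exact Finset.sum_congr rfl (fun n _ => by ring)
  have h2 : ∑ n ∈ J, (a n + v n) * (a (n + k) + v (n + k)) =
      ∑ n ∈ J, a n * a (n + k) + ∑ n ∈ J, (a n * v (n + k) + a (n + k) * v n) +
        ∑ n ∈ J, v n * v (n + k) := by
    rw [← Finset.sum_add_distrib, ← Finset.sum_add_distrib]
    exact Finset.sum_congr rfl (fun n _ => by ring)
  rw [h1, h2, sum_Ioo_mul_sub_comm k a v]
  ring

/-! ### Bilinear geometric estimates: cross terms of Lemma 19 and Lemma 21 -/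

/-- **[WZ 2020, Lemma 19, cross term].** If `|a_n| ≤ S q^{-n}` and `|v_n| ≤ T q^{-n}` for `n > m`
(`q > 1`, `S, T ≥ 0`), then for every `k` and every finite set `J` of indices `n > m`,
`Σ_{n∈J} |a_n| |v_{n+k}| ≤ S T q^{-k} · q^{-2m}/(q²-1)`.
[cite: WilczakZgliczynski2020, §5.2 Lemma 19 (order i, cross term S_j S_{i-j})] -/
theorem sum_abs_mul_add_le_of_tail₂ {q S T : ℝ} (hq : 1 < q) (hS0 : 0 ≤ S) (hT0 : 0 ≤ T) {m : ℕ}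
    {a v : ℕ → ℝ} (hS : ∀ n : ℕ, m < n → |a n| ≤ S / q ^ n)
    (hT : ∀ n : ℕ, m < n → |v n| ≤ T / q ^ n) (k : ℕ) (J : Finset ℕ) (hJ : ∀ n ∈ J, m < n) :
    ∑ n ∈ J, |a n| * |v (n + k)| ≤ S * T * (q ^ k)⁻¹ * ((q ^ (2 * m))⁻¹ / (q ^ 2 - 1)) := by
  have hq0 : 0 < q := by linarith
  have hterm : ∀ n ∈ J, |a n| * |v (n + k)| ≤ S * T * (q ^ k)⁻¹ * (q ^ (2 * n))⁻¹ := by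
    intro n hn
    have h1 := hS n (hJ n hn)
    have h2 := hT (n + k) (by have := hJ n hn; omega)
    calc |a n| * |v (n + k)| ≤ (S / q ^ n) * (T / q ^ (n + k)) :=
          mul_le_mul h1 h2 (abs_nonneg _) (by positivity)
      _ = S * T * (q ^ k)⁻¹ * (q ^ (2 * n))⁻¹ := by
          rw [two_mul, pow_add, pow_add]
          field_simp
  calc ∑ n ∈ J, |a n| * |v (n + k)| ≤ ∑ n ∈ J, S * T * (q ^ k)⁻¹ * (q ^ (2 * n))⁻¹ :=
        Finset.sum_le_sum hterm
    _ = S * T * (q ^ k)⁻¹ * ∑ n ∈ J, (q ^ (2 * n))⁻¹ := by rw [Finset.mul_sum]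
    _ ≤ S * T * (q ^ k)⁻¹ * ((q ^ (2 * m))⁻¹ / (q ^ 2 - 1)) := by
        gcongr
        exact sum_inv_pow_two_mul_le hq m J hJ

/-- **[WZ 2020, Lemma 21, block `Σ₁`, cross term]** (first sum): if `|a_n| ≤ ã_n` for
`1 ≤ n ≤ m` and `|v_n| ≤ T q^{-n}` for `n > m`, then for `k > 2m`
`Σ_{n=1}^{m} |a_n| |v_{k-n}| ≤ q^{-k} T Σ_{n=1}^{m} q^n ã_n`.
[cite: WilczakZgliczynski2020, §5.2 Lemma 21 (proof, Σ₁, cross term)] -/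
theorem sum_Icc_abs_mul_sub_le₂ {q T : ℝ} (hq : 1 < q) {m : ℕ} {a v α : ℕ → ℝ}
    (hα : ∀ n : ℕ, 1 ≤ n → n ≤ m → |a n| ≤ α n) (hT : ∀ n : ℕ, m < n → |v n| ≤ T / q ^ n)
    {k : ℕ} (hk : 2 * m < k) :
    ∑ n ∈ Finset.Icc 1 m, |a n| * |v (k - n)| ≤
      (q ^ k)⁻¹ * T * ∑ n ∈ Finset.Icc 1 m, q ^ n * α n := by
  have hq0 : 0 < q := by linarith
  rw [Finset.mul_sum]
  refine Finset.sum_le_sum (fun n hn => ?_)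
  rw [Finset.mem_Icc] at hn
  have h1 := hα n hn.1 hn.2
  have h2 := hT (k - n) (by omega)
  have hαn : 0 ≤ α n := (abs_nonneg _).trans h1
  have hkn : q ^ (k - n) = q ^ k * (q ^ n)⁻¹ := pow_sub₀ q hq0.ne' (by omega)
  calc |a n| * |v (k - n)| ≤ α n * (T / q ^ (k - n)) := mul_le_mul h1 h2 (abs_nonneg _) hαn
    _ = (q ^ k)⁻¹ * T * (q ^ n * α n) := by
        rw [hkn]
        field_simp

/-- **[WZ 2020, Lemma 21, block `Σ₁`, cross term]** (second sum): if `|a_n| ≤ ã_n` for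
`1 ≤ n ≤ m` and `|v_n| ≤ T q^{-n}` for `n > m`, then for `k > m`
`Σ_{n=1}^{m} |a_n| |v_{n+k}| ≤ q^{-k} T Σ_{n=1}^{m} q^{-n} ã_n`.
[cite: WilczakZgliczynski2020, §5.2 Lemma 21 (proof, Σ₁, cross term)] -/
theorem sum_Icc_abs_mul_add_le₂ {q T : ℝ} (hq : 1 < q) {m : ℕ} {a v α : ℕ → ℝ}
    (hα : ∀ n : ℕ, 1 ≤ n → n ≤ m → |a n| ≤ α n) (hT : ∀ n : ℕ, m < n → |v n| ≤ T / q ^ n)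
    {k : ℕ} (hk : m < k) :
    ∑ n ∈ Finset.Icc 1 m, |a n| * |v (n + k)| ≤
      (q ^ k)⁻¹ * T * ∑ n ∈ Finset.Icc 1 m, (q ^ n)⁻¹ * α n := by
  have hq0 : 0 < q := by linarith
  rw [Finset.mul_sum]
  refine Finset.sum_le_sum (fun n hn => ?_)
  rw [Finset.mem_Icc] at hn
  have h1 := hα n hn.1 hn.2
  have h2 := hT (n + k) (by omega)
  have hαn : 0 ≤ α n := (abs_nonneg _).trans h1
  calc |a n| * |v (n + k)| ≤ α n * (T / q ^ (n + k)) := mul_le_mul h1 h2 (abs_nonneg _) hαn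
    _ = (q ^ k)⁻¹ * T * ((q ^ n)⁻¹ * α n) := by
        rw [pow_add]
        field_simp

/-- **[WZ 2020, Lemma 21, block `Σ₂`, cross term]** (tail × tail): if `|a_n| ≤ S q^{-n}` and
`|v_n| ≤ T q^{-n}` for `n > m`, then `Σ_{m<n<k-m} |a_n| |v_{k-n}| ≤ q^{-k} S T (k - m - m - 1)`
(natural-number subtraction; the sum is empty for `k ≤ 2m + 1`).
[cite: WilczakZgliczynski2020, §5.2 Lemma 21 (proof, Σ₂, cross term S_j S_{i-j})] -/
theorem sum_Ioo_abs_mul_sub_le₂ {q S T : ℝ} (hq : 1 < q) (hS0 : 0 ≤ S) {m : ℕ} {a v : ℕ → ℝ}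
    (hS : ∀ n : ℕ, m < n → |a n| ≤ S / q ^ n) (hT : ∀ n : ℕ, m < n → |v n| ≤ T / q ^ n)
    (k : ℕ) :
    ∑ n ∈ Finset.Ioo m (k - m), |a n| * |v (k - n)| ≤
      (q ^ k)⁻¹ * (S * T) * ((k - m - m - 1 : ℕ) : ℝ) := by
  have hq0 : 0 < q := by linarith
  have hterm : ∀ n ∈ Finset.Ioo m (k - m), |a n| * |v (k - n)| ≤ (q ^ k)⁻¹ * (S * T) := by
    intro n hn
    rw [Finset.mem_Ioo] at hn
    have h1 := hS n hn.1
    have h2 := hT (k - n) (by omega)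
    have hkn : q ^ n * q ^ (k - n) = q ^ k := by
      rw [← pow_add, Nat.add_sub_cancel' (by omega : n ≤ k)]
    calc |a n| * |v (k - n)| ≤ (S / q ^ n) * (T / q ^ (k - n)) :=
          mul_le_mul h1 h2 (abs_nonneg _) (by positivity)
      _ = (q ^ k)⁻¹ * (S * T) := by
          rw [div_mul_div_comm, hkn]
          field_simp
  calc ∑ n ∈ Finset.Ioo m (k - m), |a n| * |v (k - n)|
      ≤ ∑ n ∈ Finset.Ioo m (k - m), (q ^ k)⁻¹ * (S * T) := Finset.sum_le_sum hterm
    _ = (q ^ k)⁻¹ * (S * T) * ((k - m - m - 1 : ℕ) : ℝ) := by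
        rw [Finset.sum_const, Nat.card_Ioo, nsmul_eq_mul]
        ring

/-- **[WZ 2020, Lemma 21, cross term]** (both blocks, exact count): if `|a_n| ≤ ã_n`,
`|v_n| ≤ b̃_n` for `1 ≤ n ≤ m` and `|a_n| ≤ S q^{-n}`, `|v_n| ≤ T q^{-n}` for `n > m`, then for
every far mode `k > 2m`,
`Σ_{n=1}^{k-1} |a_n| |v_{k-n}| ≤ q^{-k} (T Σ_{n≤m} q^n ã_n + S Σ_{n≤m} q^n b̃_n + S T (k-2m-1))`.
[cite: WilczakZgliczynski2020, §5.2 Lemma 21 (order i, cross term)] -/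
theorem sum_Ioo_abs_mul_sub_le_of_gbound₂ {q S T : ℝ} (hq : 1 < q) (hS0 : 0 ≤ S) {m : ℕ}
    {a v α β : ℕ → ℝ} (hα : ∀ n : ℕ, 1 ≤ n → n ≤ m → |a n| ≤ α n)
    (hS : ∀ n : ℕ, m < n → |a n| ≤ S / q ^ n) (hβ : ∀ n : ℕ, 1 ≤ n → n ≤ m → |v n| ≤ β n)
    (hT : ∀ n : ℕ, m < n → |v n| ≤ T / q ^ n) {k : ℕ} (hk : 2 * m < k) :
    ∑ n ∈ Finset.Ioo 0 k, |a n| * |v (k - n)| ≤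
      (q ^ k)⁻¹ * (T * ∑ n ∈ Finset.Icc 1 m, q ^ n * α n + S * ∑ n ∈ Finset.Icc 1 m, q ^ n * β n +
        S * T * ((k - 2 * m - 1 : ℕ) : ℝ)) := by
  classical
  have hsplit : Finset.Ioo 0 k =
      Finset.Icc 1 m ∪ Finset.Ioo m (k - m) ∪ Finset.Icc (k - m) (k - 1) := by
    ext n
    simp only [Finset.mem_union, Finset.mem_Ioo, Finset.mem_Icc]
    omega
  have hd1 : Disjoint (Finset.Icc 1 m) (Finset.Ioo m (k - m)) := by
    rw [Finset.disjoint_left]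
    intro n h1 h2
    rw [Finset.mem_Icc] at h1
    rw [Finset.mem_Ioo] at h2
    omega
  have hd2 : Disjoint (Finset.Icc 1 m ∪ Finset.Ioo m (k - m)) (Finset.Icc (k - m) (k - 1)) := by
    rw [Finset.disjoint_left]
    intro n h1 h2
    simp only [Finset.mem_union, Finset.mem_Icc, Finset.mem_Ioo] at h1 h2
    omega
  rw [hsplit, Finset.sum_union hd2, Finset.sum_union hd1]
  have hA := sum_Icc_abs_mul_sub_le₂ hq hα hT hk
  have hB := sum_Ioo_abs_mul_sub_le₂ hq hS0 hS hT k (m := m)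
  -- the third block is a `Σ₁` block with the roles of `a` and `v` exchanged (`n ↦ k - n`)
  have hC : ∑ n ∈ Finset.Icc (k - m) (k - 1), |a n| * |v (k - n)| ≤
      (q ^ k)⁻¹ * S * ∑ n ∈ Finset.Icc 1 m, q ^ n * β n := by
    have hinj : Set.InjOn (fun n : ℕ => k - n) ↑(Finset.Icc (k - m) (k - 1)) := by
      intro x hx y hy hxy
      simp only [Finset.coe_Icc, Set.mem_Icc] at hx hy
      simp only at hxy
      omega
    have himg : (Finset.Icc (k - m) (k - 1)).image (fun n : ℕ => k - n) = Finset.Icc 1 m := by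
      ext j
      simp only [Finset.mem_image, Finset.mem_Icc]
      constructor
      · rintro ⟨n, hn, rfl⟩
        omega
      · intro hj
        exact ⟨k - j, by omega, by omega⟩
    calc ∑ n ∈ Finset.Icc (k - m) (k - 1), |a n| * |v (k - n)|
        = ∑ n ∈ Finset.Icc (k - m) (k - 1), |a (k - (k - n))| * |v (k - n)| := by
          refine Finset.sum_congr rfl (fun n hn => ?_)
          rw [Finset.mem_Icc] at hn
          rw [Nat.sub_sub_self (by omega : n ≤ k)]
      _ = ∑ j ∈ (Finset.Icc (k - m) (k - 1)).image (fun n : ℕ => k - n), |a (k - j)| * |v j| :=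
          (Finset.sum_image (f := fun j : ℕ => |a (k - j)| * |v j|) hinj).symm
      _ = ∑ j ∈ Finset.Icc 1 m, |v j| * |a (k - j)| := by
          rw [himg]
          exact Finset.sum_congr rfl (fun j _ => mul_comm _ _)
      _ ≤ _ := sum_Icc_abs_mul_sub_le₂ hq hβ hS hk
  have e1 : ((k - m - m - 1 : ℕ) : ℝ) = ((k - 2 * m - 1 : ℕ) : ℝ) := by
    congr 1
    omega
  rw [e1] at hB
  calc _ ≤ (q ^ k)⁻¹ * T * ∑ n ∈ Finset.Icc 1 m, q ^ n * α n +
        (q ^ k)⁻¹ * (S * T) * ((k - 2 * m - 1 : ℕ) : ℝ) +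
        (q ^ k)⁻¹ * S * ∑ n ∈ Finset.Icc 1 m, q ^ n * β n := add_le_add (add_le_add hA hB) hC
    _ = _ := by ring

/-- **[WZ 2020, Lemma 21 with Lemma 19, cross term]** (the shifted sum at a mode `k > m`): if
`|a_n| ≤ ã_n` for `1 ≤ n ≤ m`, `|a_n| ≤ S q^{-n}` and `|v_n| ≤ T q^{-n}` for `n > m`, then for
every finite set `J` of indices `n ≥ 1`,
`Σ_{n∈J} |a_n| |v_{n+k}| ≤ q^{-k} T (Σ_{n=1}^{m} q^{-n} ã_n + S q^{-2m}/(q²-1))`.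
[cite: WilczakZgliczynski2020, §5.2 Lemmas 19 and 21 (order i, cross terms)] -/
theorem sum_abs_mul_add_le_of_gbound₂ {q S T : ℝ} (hq : 1 < q) (hS0 : 0 ≤ S) (hT0 : 0 ≤ T)
    {m : ℕ} {a v α : ℕ → ℝ} (hα : ∀ n : ℕ, 1 ≤ n → n ≤ m → |a n| ≤ α n)
    (hS : ∀ n : ℕ, m < n → |a n| ≤ S / q ^ n) (hT : ∀ n : ℕ, m < n → |v n| ≤ T / q ^ n)
    {k : ℕ} (hk : m < k) (J : Finset ℕ) (hJ : ∀ n ∈ J, 1 ≤ n) :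
    ∑ n ∈ J, |a n| * |v (n + k)| ≤ (q ^ k)⁻¹ * T *
      (∑ n ∈ Finset.Icc 1 m, (q ^ n)⁻¹ * α n + S * ((q ^ (2 * m))⁻¹ / (q ^ 2 - 1))) := by
  classical
  rw [← Finset.sum_filter_add_sum_filter_not J (fun n => n ≤ m)]
  have h1 : ∑ n ∈ J.filter (fun n => n ≤ m), |a n| * |v (n + k)| ≤
      (q ^ k)⁻¹ * T * ∑ n ∈ Finset.Icc 1 m, (q ^ n)⁻¹ * α n := by
    refine le_trans (Finset.sum_le_sum_of_subset_of_nonneg (fun n hn => ?_)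
      (fun n _ _ => by positivity)) (sum_Icc_abs_mul_add_le₂ hq hα hT hk)
    rw [Finset.mem_filter] at hn
    rw [Finset.mem_Icc]
    exact ⟨hJ n hn.1, hn.2⟩
  have h2 : ∑ n ∈ J.filter (fun n => ¬ n ≤ m), |a n| * |v (n + k)| ≤
      S * T * (q ^ k)⁻¹ * ((q ^ (2 * m))⁻¹ / (q ^ 2 - 1)) :=
    sum_abs_mul_add_le_of_tail₂ hq hS0 hT0 hS hT k _ (fun n hn => by
      rw [Finset.mem_filter, not_le] at hn
      exact hn.2)
  calc _ ≤ _ := add_le_add h1 h2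
    _ = _ := by ring

/-! ### The derivative of the KS nonlinearity at a far mode -/

/-- **`DN_k(a)v` on `GBound × GBound`, far mode, blocks kept separate.** If `|a_n| ≤ ã_n`,
`|v_n| ≤ b̃_n` (`1 ≤ n ≤ m`), `|a_n| ≤ S q^{-n}`, `|v_n| ≤ T q^{-n}` (`n > m`), then for `k > 2m`
and every finite `J ⊆ [1, ∞)`,
`2k Σ_{n=1}^{k-1} |a_n||v_{k-n}| + 2k Σ_{n∈J} (|a_n||v_{n+k}| + |a_{n+k}||v_n|)
  ≤ q^{-k} k (c₁ⱽ + 2 S T (k-2m-1))`,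
`c₁ⱽ = 2 (T Σ q^n ã_n + S Σ q^n b̃_n + T (Σ q^{-n} ã_n + S q^{-2m}/(q²-1))
        + S (Σ q^{-n} b̃_n + T q^{-2m}/(q²-1)))`.
[cite: WilczakZgliczynski2020, §5.2 Lemmas 19 and 21 (order i, cross terms)] -/
theorem ks_derivative_le_of_gbound {q S T : ℝ} (hq : 1 < q) (hS0 : 0 ≤ S) (hT0 : 0 ≤ T) {m : ℕ}
    {a v α β : ℕ → ℝ} (hα : ∀ n : ℕ, 1 ≤ n → n ≤ m → |a n| ≤ α n)
    (hS : ∀ n : ℕ, m < n → |a n| ≤ S / q ^ n) (hβ : ∀ n : ℕ, 1 ≤ n → n ≤ m → |v n| ≤ β n)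
    (hT : ∀ n : ℕ, m < n → |v n| ≤ T / q ^ n) {k : ℕ} (hk : 2 * m < k) (J : Finset ℕ)
    (hJ : ∀ n ∈ J, 1 ≤ n) :
    2 * (k : ℝ) * ∑ n ∈ Finset.Ioo 0 k, |a n| * |v (k - n)| +
        2 * (k : ℝ) * ∑ n ∈ J, (|a n| * |v (n + k)| + |a (n + k)| * |v n|) ≤
      (q ^ k)⁻¹ * k *
        (2 * (T * ∑ n ∈ Finset.Icc 1 m, q ^ n * α n + S * ∑ n ∈ Finset.Icc 1 m, q ^ n * β n +
            T * (∑ n ∈ Finset.Icc 1 m, (q ^ n)⁻¹ * α n + S * ((q ^ (2 * m))⁻¹ / (q ^ 2 - 1))) +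
            S * (∑ n ∈ Finset.Icc 1 m, (q ^ n)⁻¹ * β n + T * ((q ^ (2 * m))⁻¹ / (q ^ 2 - 1)))) +
          2 * S * T * ((k - 2 * m - 1 : ℕ) : ℝ)) := by
  have hA := sum_Ioo_abs_mul_sub_le_of_gbound₂ hq hS0 hα hS hβ hT hk
  have hB := sum_abs_mul_add_le_of_gbound₂ hq hS0 hT0 hα hS hT (by omega : m < k) J hJ
  -- the third sum is the second one with `a` and `v` exchanged
  have hC : ∑ n ∈ J, |a (n + k)| * |v n| ≤ (q ^ k)⁻¹ * S *
      (∑ n ∈ Finset.Icc 1 m, (q ^ n)⁻¹ * β n + T * ((q ^ (2 * m))⁻¹ / (q ^ 2 - 1))) := by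
    calc ∑ n ∈ J, |a (n + k)| * |v n| = ∑ n ∈ J, |v n| * |a (n + k)| :=
          Finset.sum_congr rfl (fun n _ => mul_comm _ _)
      _ ≤ _ := sum_abs_mul_add_le_of_gbound₂ hq hT0 hS0 hβ hT hS (by omega : m < k) J hJ
  have hk0 : (0 : ℝ) ≤ k := Nat.cast_nonneg k
  rw [Finset.sum_add_distrib]
  calc 2 * (k : ℝ) * ∑ n ∈ Finset.Ioo 0 k, |a n| * |v (k - n)| +
        2 * (k : ℝ) * (∑ n ∈ J, |a n| * |v (n + k)| + ∑ n ∈ J, |a (n + k)| * |v n|)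
      ≤ 2 * (k : ℝ) * ((q ^ k)⁻¹ * (T * ∑ n ∈ Finset.Icc 1 m, q ^ n * α n +
          S * ∑ n ∈ Finset.Icc 1 m, q ^ n * β n + S * T * ((k - 2 * m - 1 : ℕ) : ℝ))) +
        2 * (k : ℝ) * ((q ^ k)⁻¹ * T *
            (∑ n ∈ Finset.Icc 1 m, (q ^ n)⁻¹ * α n + S * ((q ^ (2 * m))⁻¹ / (q ^ 2 - 1))) +
          (q ^ k)⁻¹ * S *
            (∑ n ∈ Finset.Icc 1 m, (q ^ n)⁻¹ * β n + T * ((q ^ (2 * m))⁻¹ / (q ^ 2 - 1)))) :=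
        add_le_add (mul_le_mul_of_nonneg_left hA (by positivity))
          (mul_le_mul_of_nonneg_left (add_le_add hB hC) (by positivity))
    _ = _ := by ring

/-- The same for the signed derivative `DN_k(a)v = -2k Σ_{n=1}^{k-1} a_n v_{k-n} +
2k Σ_{n∈J} (a_n v_{n+k} + a_{n+k} v_n)` of any Galerkin truncation (`k > 2m`, `J ⊆ [1, ∞)`).
[cite: WilczakZgliczynski2020, §5.2 Lemmas 19 and 21 (order i, cross terms)] -/
theorem ks_derivative_abs_le_of_gbound {q S T : ℝ} (hq : 1 < q) (hS0 : 0 ≤ S) (hT0 : 0 ≤ T)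
    {m : ℕ} {a v α β : ℕ → ℝ} (hα : ∀ n : ℕ, 1 ≤ n → n ≤ m → |a n| ≤ α n)
    (hS : ∀ n : ℕ, m < n → |a n| ≤ S / q ^ n) (hβ : ∀ n : ℕ, 1 ≤ n → n ≤ m → |v n| ≤ β n)
    (hT : ∀ n : ℕ, m < n → |v n| ≤ T / q ^ n) {k : ℕ} (hk : 2 * m < k) (J : Finset ℕ)
    (hJ : ∀ n ∈ J, 1 ≤ n) :
    |-2 * (k : ℝ) * ∑ n ∈ Finset.Ioo 0 k, a n * v (k - n) +
        2 * (k : ℝ) * ∑ n ∈ J, (a n * v (n + k) + a (n + k) * v n)| ≤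
      (q ^ k)⁻¹ * k *
        (2 * (T * ∑ n ∈ Finset.Icc 1 m, q ^ n * α n + S * ∑ n ∈ Finset.Icc 1 m, q ^ n * β n +
            T * (∑ n ∈ Finset.Icc 1 m, (q ^ n)⁻¹ * α n + S * ((q ^ (2 * m))⁻¹ / (q ^ 2 - 1))) +
            S * (∑ n ∈ Finset.Icc 1 m, (q ^ n)⁻¹ * β n + T * ((q ^ (2 * m))⁻¹ / (q ^ 2 - 1)))) +
          2 * S * T * ((k - 2 * m - 1 : ℕ) : ℝ)) := by
  refine le_trans ?_ (ks_derivative_le_of_gbound hq hS0 hT0 hα hS hβ hT hk J hJ)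
  have hk0 : (0 : ℝ) ≤ k := Nat.cast_nonneg k
  have h1 : |-2 * (k : ℝ) * ∑ n ∈ Finset.Ioo 0 k, a n * v (k - n)| ≤
      2 * (k : ℝ) * ∑ n ∈ Finset.Ioo 0 k, |a n| * |v (k - n)| := by
    rw [abs_mul, show |-2 * (k : ℝ)| = 2 * k by
      rw [abs_of_nonpos (by linarith)]; ring]
    refine mul_le_mul_of_nonneg_left ((Finset.abs_sum_le_sum_abs _ _).trans (le_of_eq ?_))
      (by positivity)
    exact Finset.sum_congr rfl (fun n _ => abs_mul _ _)
  have h2 : |2 * (k : ℝ) * ∑ n ∈ J, (a n * v (n + k) + a (n + k) * v n)| ≤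
      2 * (k : ℝ) * ∑ n ∈ J, (|a n| * |v (n + k)| + |a (n + k)| * |v n|) := by
    rw [abs_mul, abs_of_nonneg (by positivity : (0 : ℝ) ≤ 2 * k)]
    refine mul_le_mul_of_nonneg_left ((Finset.abs_sum_le_sum_abs _ _).trans
      (Finset.sum_le_sum (fun n _ => ?_))) (by positivity)
    calc |a n * v (n + k) + a (n + k) * v n| ≤ |a n * v (n + k)| + |a (n + k) * v n| :=
          abs_add_le _ _
      _ = |a n| * |v (n + k)| + |a (n + k)| * |v n| := by rw [abs_mul, abs_mul]
  exact (abs_add_le _ _).trans (add_le_add h1 h2)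

/-- **`|DN_k(a)v| ≤ q^{-k} k (c₁ⱽ + c₂ⱽ k)`**, `c₂ⱽ = 2 S T`: the weakening `k - 2m - 1 ≤ k` used to
get a bound of the shape `q^{-k} k (c₁ + c₂ k)` (to which `far_weighted_le` applies).
[cite: WilczakZgliczynski2020, §5.2 Lemma 21 (|Σ₂| ≤ k q^{-k} Σ S_j S_{i-j})] -/
theorem ks_derivative_le_of_gbound' {q S T : ℝ} (hq : 1 < q) (hS0 : 0 ≤ S) (hT0 : 0 ≤ T)
    {m : ℕ} {a v α β : ℕ → ℝ} (hα : ∀ n : ℕ, 1 ≤ n → n ≤ m → |a n| ≤ α n)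
    (hS : ∀ n : ℕ, m < n → |a n| ≤ S / q ^ n) (hβ : ∀ n : ℕ, 1 ≤ n → n ≤ m → |v n| ≤ β n)
    (hT : ∀ n : ℕ, m < n → |v n| ≤ T / q ^ n) {k : ℕ} (hk : 2 * m < k) (J : Finset ℕ)
    (hJ : ∀ n ∈ J, 1 ≤ n) :
    |-2 * (k : ℝ) * ∑ n ∈ Finset.Ioo 0 k, a n * v (k - n) +
        2 * (k : ℝ) * ∑ n ∈ J, (a n * v (n + k) + a (n + k) * v n)| ≤
      (q ^ k)⁻¹ * k *
        (2 * (T * ∑ n ∈ Finset.Icc 1 m, q ^ n * α n + S * ∑ n ∈ Finset.Icc 1 m, q ^ n * β n +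
            T * (∑ n ∈ Finset.Icc 1 m, (q ^ n)⁻¹ * α n + S * ((q ^ (2 * m))⁻¹ / (q ^ 2 - 1))) +
            S * (∑ n ∈ Finset.Icc 1 m, (q ^ n)⁻¹ * β n + T * ((q ^ (2 * m))⁻¹ / (q ^ 2 - 1)))) +
          2 * S * T * k) := by
  refine (ks_derivative_abs_le_of_gbound hq hS0 hT0 hα hS hβ hT hk J hJ).trans ?_
  have hq0 : 0 < q := by linarith
  have hk1 : ((k - 2 * m - 1 : ℕ) : ℝ) ≤ k := by
    have : k - 2 * m - 1 ≤ k := by omega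
    exact_mod_cast this
  have hqk : 0 ≤ (q ^ k)⁻¹ * k := by positivity
  refine mul_le_mul_of_nonneg_left (add_le_add le_rfl ?_) hqk
  exact mul_le_mul_of_nonneg_left hk1 (by positivity)

/-- **The uniform far ratio for the derivative**: under the hypotheses above, at every mode
`k ≥ K` with `K > 2m` and `ν K² > 1`,
`q^k |DN_k(a)v|/(νk⁴ - k²) ≤ (c₁ⱽ/K + c₂ⱽ)/(νK² - 1)` (`c₂ⱽ = 2 S T`).
[cite: WilczakZgliczynski2020, §4.3 (proof of Lemma 18) with §5.2 Lemmas 19, 21] -/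
theorem ks_derivative_far_ratio_le {q S T ν : ℝ} (hq : 1 < q) (hS0 : 0 ≤ S) (hT0 : 0 ≤ T)
    (hν : 0 < ν) {m : ℕ} {a v α β : ℕ → ℝ} (hα : ∀ n : ℕ, 1 ≤ n → n ≤ m → |a n| ≤ α n)
    (hS : ∀ n : ℕ, m < n → |a n| ≤ S / q ^ n) (hβ : ∀ n : ℕ, 1 ≤ n → n ≤ m → |v n| ≤ β n)
    (hT : ∀ n : ℕ, m < n → |v n| ≤ T / q ^ n) {K k : ℕ} (hK : 2 * m < K)
    (hνK : 1 < ν * (K : ℝ) ^ 2) (hk : K ≤ k) (J : Finset ℕ) (hJ : ∀ n ∈ J, 1 ≤ n) :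
    q ^ k * |-2 * (k : ℝ) * ∑ n ∈ Finset.Ioo 0 k, a n * v (k - n) +
        2 * (k : ℝ) * ∑ n ∈ J, (a n * v (n + k) + a (n + k) * v n)| /
        (ν * (k : ℝ) ^ 4 - (k : ℝ) ^ 2) ≤
      ((2 * (T * ∑ n ∈ Finset.Icc 1 m, q ^ n * α n + S * ∑ n ∈ Finset.Icc 1 m, q ^ n * β n +
            T * (∑ n ∈ Finset.Icc 1 m, (q ^ n)⁻¹ * α n + S * ((q ^ (2 * m))⁻¹ / (q ^ 2 - 1))) +
            S * (∑ n ∈ Finset.Icc 1 m, (q ^ n)⁻¹ * β n + T * ((q ^ (2 * m))⁻¹ / (q ^ 2 - 1))))) /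
          K + 2 * S * T) / (ν * (K : ℝ) ^ 2 - 1) := by
  have hq0 : 0 < q := by linarith
  have hx := ks_derivative_le_of_gbound' hq hS0 hT0 hα hS hβ hT (by omega : 2 * m < k) J hJ
  have hc₁ : 0 ≤ 2 * (T * ∑ n ∈ Finset.Icc 1 m, q ^ n * α n +
      S * ∑ n ∈ Finset.Icc 1 m, q ^ n * β n +
      T * (∑ n ∈ Finset.Icc 1 m, (q ^ n)⁻¹ * α n + S * ((q ^ (2 * m))⁻¹ / (q ^ 2 - 1))) +
      S * (∑ n ∈ Finset.Icc 1 m, (q ^ n)⁻¹ * β n + T * ((q ^ (2 * m))⁻¹ / (q ^ 2 - 1)))) := by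
    have hq2 : 0 < q ^ 2 - 1 := by nlinarith
    have hαs : 0 ≤ ∑ n ∈ Finset.Icc 1 m, q ^ n * α n :=
      Finset.sum_nonneg (fun n hn => by
        rw [Finset.mem_Icc] at hn
        exact mul_nonneg (by positivity) ((abs_nonneg _).trans (hα n hn.1 hn.2)))
    have hβs : 0 ≤ ∑ n ∈ Finset.Icc 1 m, q ^ n * β n :=
      Finset.sum_nonneg (fun n hn => by
        rw [Finset.mem_Icc] at hn
        exact mul_nonneg (by positivity) ((abs_nonneg _).trans (hβ n hn.1 hn.2)))
    have hαs' : 0 ≤ ∑ n ∈ Finset.Icc 1 m, (q ^ n)⁻¹ * α n :=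
      Finset.sum_nonneg (fun n hn => by
        rw [Finset.mem_Icc] at hn
        exact mul_nonneg (by positivity) ((abs_nonneg _).trans (hα n hn.1 hn.2)))
    have hβs' : 0 ≤ ∑ n ∈ Finset.Icc 1 m, (q ^ n)⁻¹ * β n :=
      Finset.sum_nonneg (fun n hn => by
        rw [Finset.mem_Icc] at hn
        exact mul_nonneg (by positivity) ((abs_nonneg _).trans (hβ n hn.1 hn.2)))
    positivity
  exact far_weighted_le hν hc₁ (by positivity) hq0 hνK hk (by
    calc _ ≤ _ := hx
      _ = _ := by ring)

/-- The analogous weakening for the quadratic bound of `GeometricDecayConvolution.lean`: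
`k Σ_{n=1}^{k-1} |a_n||a_{k-n}| + 2k Σ_{n∈J} |a_n||a_{n+k}| ≤ q^{-k} k (c₁ + S² k)` (`k > 2m`).
[cite: WilczakZgliczynski2020, §5.2 Lemma 21 (|Σ₂| ≤ k q^{-k} Σ S_j S_{i-j})] -/
theorem ks_quadratic_le_of_gbound' {q S : ℝ} (hq : 1 < q) (hS0 : 0 ≤ S) {m : ℕ} {a α : ℕ → ℝ}
    (hα : ∀ n : ℕ, 1 ≤ n → n ≤ m → |a n| ≤ α n) (hS : ∀ n : ℕ, m < n → |a n| ≤ S / q ^ n)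
    {k : ℕ} (hk : 2 * m < k) (J : Finset ℕ) (hJ : ∀ n ∈ J, 1 ≤ n) :
    (k : ℝ) * ∑ n ∈ Finset.Ioo 0 k, |a n| * |a (k - n)| +
        2 * (k : ℝ) * ∑ n ∈ J, |a n| * |a (n + k)| ≤
      (q ^ k)⁻¹ * k * (2 * S * (∑ n ∈ Finset.Icc 1 m, q ^ n * α n +
        ∑ n ∈ Finset.Icc 1 m, (q ^ n)⁻¹ * α n + S * ((q ^ (2 * m))⁻¹ / (q ^ 2 - 1))) +
        S ^ 2 * k) := by
  refine (ks_quadratic_le_of_gbound hq hS0 hα hS hk J hJ).trans ?_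
  have hq0 : 0 < q := by linarith
  have hk1 : ((k - 2 * m - 1 : ℕ) : ℝ) ≤ k := by
    have : k - 2 * m - 1 ≤ k := by omega
    exact_mod_cast this
  have hqk : 0 ≤ (q ^ k)⁻¹ * k := by positivity
  refine mul_le_mul_of_nonneg_left (add_le_add le_rfl ?_) hqk
  exact mul_le_mul_of_nonneg_left hk1 (by positivity)

end Literature.Analysis.ODE
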